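import Mathlib
import Literature.MathematicalPhysics.QuantumFieldTheory.Balaban1983to89.T4SliceOperatorData

/-!
# T⁴ programme, node NE3 — the slice-operator TORUS MODEL, file 2/4: the BLOCK MODEL of B9's data
# (a `B9.Geometry` whose sites are blocks; the matrix carriers making `RowObservedBy` / `EntryDominated` THEOREMS)

Series purpose, dictionary and printed wordings [R]: header of `SliceTorusBlocks` (file 1/4).  THIS FILE [model, proved;
finite sums and sups, real arithmetic], generic over a finite fine lattice `X`, a block-index type `S` and a block map
`blk : X → S`: `blockGeom blk dist j L M : B9.Geometry` — sites = blocks, every site of scale `j` (`η = 1`, lattice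
units, `len ≡ L^j`), test functions `Loc = X → ℝ` with `suppIn λ y ⟺ λ ≡ 0 off Δ(y)` and `supNorm = ` the sup norm
`supNorm'`, the norms / cut-offs of the unused clauses (3.43)–(3.47) trivial, B9's `M` a free parameter; the MATRIX
CARRIERS `matrixFamily A : B9.KernelFamily` (`e m U λ y = sup_{x∈Δ(y)}|(A_m(U)λ)(x)|` — the four entries of (3.42)
observed literally as printed, `cubeSup`) and `fineKernelOf F : B9.FineKernel` (`ker n U y y′ = sup_{z∈Δ(y), w∈Δ(y′)}
|F_n(U)(z,w)|` — (3.49) literally).  THE DICTIONARIES ARE THEOREMS: `rowObservedBy_matrixFamily` (the sign pattern of a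
row on a block is a test function supported in the block, of sup norm `≤ 1`, observing the row mass) and
`entryDominated_fineKernelOf` (an entry is at most the sup over its two blocks).  WHAT THE TYPED BUNDLES MEAN for the
carriers: `ineq342_matrixFamily_iff` ((3.42) cube-sup bounds exactly; (3.46)/(3.47) vacuous in the model),
`ineq349_fineKernelOf_iff`; the KERNEL FORMS imply them: `ineq342_matrixFamily_of_rowBounds` (cube-localised row masses
`Σ_{z∈y₁}|A_m x z| ≤ B₀·pref4(L^j)_m·e^{−δ₀dist(blk x, y₁)}` ⇒ the typed (3.42)), `ineq349_fineKernelOf_of_entryBounds`;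
and the Hölder block (3.43)–(3.45) holds trivially for the carriers with constants `0` (`ineq343_345_matrixFamily`).
With the converses `rowLocalised_of_342` / `pointwise_item3_of_349` of `T4SliceOperatorData`, the typed (3.42)/(3.49) of
the model ARE the families of kernel bounds: the dictionaries hide no strength and add none.

Honest framing (all four files): finite-T⁴ ultraviolet bookkeeping about MINIMISERS (rung (B)+1 of the cell's ladder); no
conditional of the cell (`BetaPertH`, (B), (B^μ)) is used or hidden; nothing bears on infinite volume, a mass gap, or the
Clay problem; NE3 is NOT proved — the value is a typed skeleton with the gap located (the hypotheses of
`SliceTorusSkeleton.ne3Shape_torus_of_printedStatements`).  ABSOLUTE RULE of the cell kept: no internally-minted statement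
enters as a cited fact; B9's theorems enter only as HYPOTHESES of the tree's typed, cite-tagged shapes; the manuscripts
under audit are not cited for any disputed step.  No `sorry`, no axioms beyond Mathlib's; integer/real arithmetic, finite
sums and sups are [folklore]; every [model] sentence is dictionary, never a hypothesis discharged by citation.  PLACEMENT
(human rule 2026-08-19): new cell work lives under `Summits/QuantumFields/BalabanUV/`; this series imports the lineage's
earlier leaves where they landed (`Literature.….Balaban1983to89.T4SliceOperatorData` v1.1 p193857, `B12Decay510Torus`)
and moves nothing.  Records: `t4/T4-EST-U1b-OSC.md` v1.22 (RESULTS 28, 29), `t4/T4-EST-NE3-P1.md` v2.20, GAPS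
G-ne3p1-35/36 of the cell `pub-balaban` (HOME `run/shared/lean/pub/pub-balaban/`).
-/

noncomputable section

open Finset Real

namespace Summit.QuantumFields.BalabanUV.T4Continuum.SliceTorusBlockModel

open Literature.MathematicalPhysics.QuantumFieldTheory.Balaban1983to89
open Literature.MathematicalPhysics.QuantumFieldTheory.Balaban1983to89.T4SliceOperatorData

/-! ## §3  The BLOCK MODEL of B9's data: a `B9.Geometry` whose sites are blocks, whose test functions are real
functions on the fine lattice, and the matrix carriers making `RowObservedBy` / `EntryDominated` theorems -/
section BlockModel

variable {X S : Type} [Fintype X] [DecidableEq S]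

/-- The sup norm `max_z |λ z|` of a real function on a finite lattice (`0` on the empty lattice). [folklore] -/
def supNorm' (lam : X → ℝ) : ℝ :=
  if h : (Finset.univ : Finset X).Nonempty then Finset.univ.sup' h (fun z => |lam z|) else 0

/-- `|λ z| ≤ |λ|`. [folklore] -/
theorem abs_le_supNorm' (lam : X → ℝ) (z : X) : |lam z| ≤ supNorm' lam := by
  have h : (Finset.univ : Finset X).Nonempty := ⟨z, Finset.mem_univ z⟩
  rw [supNorm', dif_pos h]
  exact Finset.le_sup' (fun z => |lam z|) (Finset.mem_univ z)

/-- `|λ| ≤ s` as soon as `|λ z| ≤ s` for all `z` (and `s ≥ 0`). [folklore] -/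
theorem supNorm'_le {lam : X → ℝ} {s : ℝ} (hs : 0 ≤ s) (h : ∀ z, |lam z| ≤ s) : supNorm' lam ≤ s := by
  unfold supNorm'
  split_ifs with hne
  · exact Finset.sup'_le _ _ fun z _ => h z
  · exact hs

/-- `0 ≤ |λ|`. [folklore] -/
theorem supNorm'_nonneg (lam : X → ℝ) : 0 ≤ supNorm' lam := by
  unfold supNorm'
  split_ifs with hne
  · obtain ⟨z, hz⟩ := hne
    exact (abs_nonneg (lam z)).trans (Finset.le_sup' (fun z => |lam z|) hz)
  · exact le_rfl

/-- The sup of `f` over the block `y` (`0` on an empty block): the "sup over x ∈ Δ(y)" of (3.42)/(3.49). [folklore] -/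
def cubeSup (blk : X → S) (f : X → ℝ) (y : S) : ℝ :=
  if h : (Finset.univ.filter fun x => blk x = y).Nonempty then
    (Finset.univ.filter fun x => blk x = y).sup' h f else 0

/-- `f x ≤ sup_{Δ(blk x)} f`. [folklore] -/
theorem le_cubeSup (blk : X → S) (f : X → ℝ) (x : X) : f x ≤ cubeSup blk f (blk x) := by
  have hx : x ∈ Finset.univ.filter fun x' => blk x' = blk x := Finset.mem_filter.2 ⟨Finset.mem_univ x, rfl⟩
  have h : (Finset.univ.filter fun x' => blk x' = blk x).Nonempty := ⟨x, hx⟩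
  rw [cubeSup, dif_pos h]
  exact Finset.le_sup' f hx

/-- `sup_{Δ(y)} f ≤ s` as soon as `f ≤ s` on `Δ(y)` (and `s ≥ 0`). [folklore] -/
theorem cubeSup_le {blk : X → S} {f : X → ℝ} {y : S} {s : ℝ} (hs : 0 ≤ s) (h : ∀ x, blk x = y → f x ≤ s) :
    cubeSup blk f y ≤ s := by
  unfold cubeSup
  split_ifs with hne
  · exact Finset.sup'_le _ _ fun x hx => h x (Finset.mem_filter.1 hx).2
  · exact hs

/-- `0 ≤ sup_{Δ(y)} f` for `f ≥ 0`. [folklore] -/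
theorem cubeSup_nonneg {blk : X → S} {f : X → ℝ} (hf : ∀ x, 0 ≤ f x) (y : S) : 0 ≤ cubeSup blk f y := by
  unfold cubeSup
  split_ifs with hne
  · obtain ⟨x, hx⟩ := hne
    exact (hf x).trans (Finset.le_sup' f hx)
  · exact le_rfl

/-- **The BLOCK MODEL of B9's geometry at one level `j`** [model]: sites = the blocks `S` (B9's `Λ_j`, reached by the
block map `blk : X → S` — `x ∈ Δ(y)` reads `blk x = y`), every site of scale `j` (`len ≡ L^j`, `η = 1`: lattice
units), `dist` = the given block distance, test functions `Loc` = real functions on the fine lattice `X` with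
`suppIn λ y` = "λ vanishes off Δ(y)" and `supNorm` = the sup norm; the L²/weighted/Hölder norms and the cut-offs,
which only enter the clauses (3.43)–(3.47) not used by the NE3 chain, are set to the trivial values `0`/`True` (so that
those clauses hold vacuously for the model families below — `ineq342_matrixFamily_iff`).  A MODEL: B9's λ are
𝔤-valued and its kernels matrix-valued; here everything is a scalar majorant. [model] [folklore] -/
abbrev blockGeom (blk : X → S) (dist : S → S → ℝ) (j : ℕ) (L M : ℝ) : B9.Geometry where
  Site := S
  scale := fun _ => j
  dist := dist
  k := j
  eta := 1
  L := L
  M := M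
  Loc := X → ℝ
  suppIn := fun lam y => ∀ z, blk z ≠ y → lam z = 0
  suppInT := fun lam y => ∀ z, blk z ≠ y → lam z = 0
  supNorm := supNorm'
  l2Norm := fun _ => 0
  wNorm := fun _ _ => 0
  holder := fun _ _ => 0
  Cut := PUnit
  cutIn := fun _ _ => True
  cutInT := fun _ _ => True
  cutH := fun _ _ => 0
  cutSup := fun _ => 0
  suppInT_of_suppIn := fun _ _ h => h
  cutInT_of_cutIn := fun _ _ h => h

omit [DecidableEq S] in
/-- Every site of the level-`j` block model has length `L^j` (the binder `hlen`). [folklore] -/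
theorem len_blockGeom (blk : X → S) (dist : S → S → ℝ) (j : ℕ) (L M : ℝ) (y : S) :
    (blockGeom blk dist j L M).len y = L ^ j := by
  simp [B9.Geometry.len]

variable {Bg : B9.Backgrounds}

/-- **The MATRIX CARRIER of a `B9.KernelFamily`** [model]: four background-dependent real matrices `A m U` on the fine
lattice (the kernels of `G`, `∇_UG`, `G∇*_U`, `Δ_UG` in the scalar-majorant model), observed exactly as (3.42) says —
`e m U λ y = sup_{x ∈ Δ(y)} |(A m U λ)(x)|`; the quantities of (3.43)–(3.47) are set to `0`. [model] [folklore] -/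
def matrixFamily (blk : X → S) (dist : S → S → ℝ) (j : ℕ) (L M : ℝ) (A : Fin 4 → Bg.Cfg → Matrix X X ℝ) :
    B9.KernelFamily (blockGeom blk dist j L M) Bg where
  e := fun m U lam y => cubeSup blk (fun x => |∑ z, A m U x z * lam z|) y
  h1 := fun _ _ _ _ => 0
  e4 := fun _ _ _ => 0
  h2 := fun _ _ _ _ => 0
  l2 := fun _ _ _ _ => 0
  glob := fun _ _ _ _ => 0

/-- **`RowObservedBy` IS A THEOREM for the matrix carrier**: the sign pattern of the row `x` on the block `y₁`
(extended by `0`) is a test function supported in `Δ(y₁)` of sup norm `≤ 1` observing the row mass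
`Σ_{z ∈ y₁}|A x z| = |(Aλ)(x)| ≤ sup_{Δ(blk x)}|Aλ|`. [folklore] -/
theorem rowObservedBy_matrixFamily (blk : X → S) (dist : S → S → ℝ) (j : ℕ) (L M : ℝ)
    (A : Fin 4 → Bg.Cfg → Matrix X X ℝ) (U : Bg.Cfg) (m : Fin 4) :
    RowObservedBy (matrixFamily blk dist j L M A) U m (A m U) blk := by
  classical
  intro x y₁
  refine ⟨fun z => if blk z = y₁ then (if 0 ≤ A m U x z then 1 else -1) else 0, ?_, ?_, ?_⟩
  · intro z hz
    simp [hz]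
  · refine supNorm'_le zero_le_one fun z => ?_
    split_ifs <;> simp
  · have hsum : ∑ z ∈ Finset.univ.filter (fun z => blk z = y₁), |A m U x z|
        = ∑ z, A m U x z * (if blk z = y₁ then (if 0 ≤ A m U x z then 1 else -1) else 0) := by
      rw [Finset.sum_filter]
      refine Finset.sum_congr rfl fun z _ => ?_
      split_ifs with h1 h2
      · rw [abs_of_nonneg h2, mul_one]
      · rw [abs_of_neg (lt_of_not_ge h2), mul_neg, mul_one]
      · rw [mul_zero]
    rw [hsum]
    exact (le_abs_self _).trans
      (le_cubeSup blk (fun x' => |∑ z, A m U x' z * (if blk z = y₁ then (if 0 ≤ A m U x z then 1 else -1) else 0)|) x)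

/-- **The MATRIX CARRIER of a `B9.FineKernel`** [model]: four background-dependent real matrices `F n U` (the kernels
`P`, `DP`, `PD*`, `DPD*`), observed exactly as (3.49) says — `ker n U y y′ = sup_{z ∈ Δ(y), w ∈ Δ(y′)} |F n U z w|`.
[model] [folklore] -/
def fineKernelOf (blk : X → S) (dist : S → S → ℝ) (j : ℕ) (L M : ℝ) (F : Fin 4 → Bg.Cfg → Matrix X X ℝ) :
    B9.FineKernel (blockGeom blk dist j L M) Bg where
  ker := fun n U y y' => cubeSup blk (fun z => cubeSup blk (fun w => |F n U z w|) y') y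

/-- **`EntryDominated` IS A THEOREM for the matrix carrier**: an entry is at most the sup over its two blocks. [folklore] -/
theorem entryDominated_fineKernelOf (blk : X → S) (dist : S → S → ℝ) (j : ℕ) (L M : ℝ)
    (F : Fin 4 → Bg.Cfg → Matrix X X ℝ) (U : Bg.Cfg) (n : Fin 4) :
    EntryDominated (fineKernelOf blk dist j L M F) U n (F n U) blk := by
  intro z w
  exact (le_cubeSup blk (fun w' => |F n U z w'|) w).trans
    (le_cubeSup blk (fun z' => cubeSup blk (fun w' => |F n U z' w'|) (blk w)) z)

/-- **What the typed (3.42)/(3.46)/(3.47) bundle MEANS for the matrix carrier**: exactly its clause (3.42) — the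
cube-sup bounds `sup_{x∈Δ(y)}|(A_mλ)(x)| ≤ B₀·pref4(L^j)_m·e^{−δ₀ dist(y,y′)}·|λ|` for `λ` vanishing off `Δ(y′)`;
the clauses (3.46), (3.47) hold trivially in the model (both sides `0`). [folklore] -/
theorem ineq342_matrixFamily_iff (blk : X → S) (dist : S → S → ℝ) (j : ℕ) (L M : ℝ)
    (A : Fin 4 → Bg.Cfg → Matrix X X ℝ) (B₀ δ₀ : ℝ) (U : Bg.Cfg) :
    B9.Ineq342_346_347 (matrixFamily blk dist j L M A) B₀ δ₀ U ↔
      ∀ (m : Fin 4) (lam : X → ℝ) (y y' : S), (∀ z, blk z ≠ y' → lam z = 0) →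
        cubeSup blk (fun x => |∑ z, A m U x z * lam z|) y
          ≤ B₀ * B9.pref4 (L ^ j) m * Real.exp (-(δ₀ * dist y y')) * supNorm' lam := by
  have hlen := len_blockGeom blk dist j L M
  constructor
  · intro h m lam y y' hsupp
    have := h.1 m lam y y' hsupp
    rw [hlen] at this
    exact this
  · intro h
    refine ⟨fun m lam y y' hsupp => ?_, fun n lam hh y y' _ _ => ?_, fun n lam γ _ _ => ?_⟩
    · rw [hlen]; exact h m lam y y' hsupp
    · show (0 : ℝ) ≤ B₀ * B9.pref6 _ n * 0 * Real.exp (-(δ₀ * dist y y')) * 0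
      simp
    · show (0 : ℝ) ≤ B₀ * 0
      simp

/-- **Kernel form ⇒ the typed (3.42) for the matrix carrier**: cube-localised ROW-MASS bounds
`Σ_{z ∈ y₁}|A_m x z| ≤ B₀·pref4(L^j)_m·e^{−δ₀ dist(blk x, y₁)}` (all items `m`, all rows `x`, all blocks `y₁`) imply
`B9.Ineq342_346_347 (matrixFamily A) B₀ δ₀ U` — together with `rowObservedBy_matrixFamily` +
`T4SliceOperatorData.rowLocalised_of_342` (the converse) the typed (3.42) of the model IS the family of row-mass bounds:
the dictionary hides no strength. [folklore] -/
theorem ineq342_matrixFamily_of_rowBounds (blk : X → S) (dist : S → S → ℝ) (j : ℕ) {L : ℝ} (M : ℝ)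
    (A : Fin 4 → Bg.Cfg → Matrix X X ℝ) {B₀ δ₀ : ℝ} (U : Bg.Cfg) (hB₀ : 0 ≤ B₀) (hL : 0 ≤ L)
    (h : ∀ (m : Fin 4) (x : X) (y₁ : S), ∑ z ∈ Finset.univ.filter (fun z => blk z = y₁), |A m U x z|
      ≤ B₀ * B9.pref4 (L ^ j) m * Real.exp (-(δ₀ * dist (blk x) y₁))) :
    B9.Ineq342_346_347 (matrixFamily blk dist j L M A) B₀ δ₀ U := by
  classical
  rw [ineq342_matrixFamily_iff]
  intro m lam y y' hsupp
  have hp : 0 ≤ B9.pref4 (L ^ j) m := B9FromB6.pref4_nonneg (pow_nonneg hL j) m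
  have hrhs : 0 ≤ B₀ * B9.pref4 (L ^ j) m * Real.exp (-(δ₀ * dist y y')) * supNorm' lam :=
    mul_nonneg (mul_nonneg (mul_nonneg hB₀ hp) (Real.exp_nonneg _)) (supNorm'_nonneg lam)
  refine cubeSup_le hrhs fun x hx => ?_
  have h1 : |∑ z, A m U x z * lam z| ≤ ∑ z ∈ Finset.univ.filter (fun z => blk z = y'), |A m U x z| * supNorm' lam := by
    calc |∑ z, A m U x z * lam z| = |∑ z ∈ Finset.univ.filter (fun z => blk z = y'), A m U x z * lam z| := by
            rw [Finset.sum_filter]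
            congr 1
            refine Finset.sum_congr rfl fun z _ => ?_
            split_ifs with hz
            · rfl
            · rw [hsupp z hz, mul_zero]
      _ ≤ ∑ z ∈ Finset.univ.filter (fun z => blk z = y'), |A m U x z * lam z| := Finset.abs_sum_le_sum_abs _ _
      _ ≤ ∑ z ∈ Finset.univ.filter (fun z => blk z = y'), |A m U x z| * supNorm' lam :=
            Finset.sum_le_sum fun z _ => by
              rw [abs_mul]
              exact mul_le_mul_of_nonneg_left (abs_le_supNorm' lam z) (abs_nonneg _)
  rw [← Finset.sum_mul] at h1
  calc |∑ z, A m U x z * lam z| ≤ (∑ z ∈ Finset.univ.filter (fun z => blk z = y'), |A m U x z|) * supNorm' lam := h1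
    _ ≤ B₀ * B9.pref4 (L ^ j) m * Real.exp (-(δ₀ * dist (blk x) y')) * supNorm' lam :=
          mul_le_mul_of_nonneg_right (h m x y') (supNorm'_nonneg lam)
    _ = _ := by rw [hx]

/-- The Hölder block (3.43)–(3.45) HOLDS TRIVIALLY for the matrix carrier with the constants `B₀(β) = B′₀(ε) =
B′₀(ε,β) = 0` (the model's Hölder norms and cut-off heights are `0`): the printed family statement `B9.Thm31Printed`
for a model family therefore carries EXACTLY the (3.42) content (`ineq342_matrixFamily_iff`) — used in §5c to show
that the by-name hypothesis of §5b is satisfiable and not stronger than the kernel-bound family. [folklore] -/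
theorem ineq343_345_matrixFamily (blk : X → S) (dist : S → S → ℝ) (j : ℕ) (L M : ℝ)
    (A : Fin 4 → Bg.Cfg → Matrix X X ℝ) (δ₀ : ℝ) (U : Bg.Cfg) :
    B9.Ineq343_345 (matrixFamily blk dist j L M A) (fun _ => 0) (fun _ => 0) (fun _ _ => 0) δ₀ U := by
  refine ⟨fun β lam ζ y y' _ _ _ _ => ?_, fun ε lam y y' _ _ _ => ?_, fun ε β lam ζ y y' _ _ _ _ _ _ => ?_⟩
  · show (0 : ℝ) ≤ 0 * _ * _ * _ * _
    simp
  · show (0 : ℝ) ≤ 0 * _ * _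
    simp
  · show (0 : ℝ) ≤ 0 * _ * _ * _ * _
    simp

/-- **What the typed (3.49) MEANS for the matrix carrier**: the two-block sup bounds
`sup_{z∈Δ(y), w∈Δ(y′)}|F_n z w| ≤ C·pref4inv(L^j)_n·(L^j)^{−d}·e^{−(δ₀/2)dist(y,y′)}`. [folklore] -/
theorem ineq349_fineKernelOf_iff (blk : X → S) (dist : S → S → ℝ) (j : ℕ) (L M : ℝ)
    (F : Fin 4 → Bg.Cfg → Matrix X X ℝ) (d : ℕ) (C δ₀ : ℝ) (U : Bg.Cfg) :
    B9.Ineq349 d (fineKernelOf blk dist j L M F) C δ₀ U ↔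
      ∀ (n : Fin 4) (y y' : S), cubeSup blk (fun z => cubeSup blk (fun w => |F n U z w|) y') y
        ≤ C * B9.pref4inv (L ^ j) n * (L ^ j) ^ (-(d : ℝ)) * Real.exp (-(δ₀ / 2 * dist y y')) := by
  have hlen := len_blockGeom blk dist j L M
  constructor
  · intro h n y y'
    have := h n y y'
    rw [hlen, hlen] at this
    exact this
  · intro h n y y'
    rw [hlen, hlen]
    exact h n y y'

/-- **Kernel form ⇒ the typed (3.49) for the matrix carrier**: ENTRYWISE bounds
`|F_n z w| ≤ C·pref4inv(L^j)_n·(L^j)^{−d}·e^{−(δ₀/2)dist(blk z, blk w)}` imply `B9.Ineq349 d (fineKernelOf F) C δ₀ U`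
(with `entryDominated_fineKernelOf` + `T4SliceOperatorData.pointwise_item3_of_349` the converse: the typed (3.49) of
the model IS the family of entrywise bounds). [folklore] -/
theorem ineq349_fineKernelOf_of_entryBounds (blk : X → S) (dist : S → S → ℝ) (j : ℕ) {L : ℝ} (M : ℝ)
    (F : Fin 4 → Bg.Cfg → Matrix X X ℝ) {d : ℕ} {C δ₀ : ℝ} (U : Bg.Cfg) (hC : 0 ≤ C) (hL : 0 < L)
    (h : ∀ (n : Fin 4) (z w : X), |F n U z w|
      ≤ C * B9.pref4inv (L ^ j) n * (L ^ j) ^ (-(d : ℝ)) * Real.exp (-(δ₀ / 2 * dist (blk z) (blk w)))) :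
    B9.Ineq349 d (fineKernelOf blk dist j L M F) C δ₀ U := by
  rw [ineq349_fineKernelOf_iff]
  intro n y y'
  have hLj : 0 < L ^ j := pow_pos hL j
  have hpi : 0 ≤ B9.pref4inv (L ^ j) n := by
    fin_cases n <;> simp [B9.pref4inv] <;> positivity
  have hrhs : 0 ≤ C * B9.pref4inv (L ^ j) n * (L ^ j) ^ (-(d : ℝ)) * Real.exp (-(δ₀ / 2 * dist y y')) :=
    mul_nonneg (mul_nonneg (mul_nonneg hC hpi) (Real.rpow_nonneg hLj.le _)) (Real.exp_nonneg _)
  refine cubeSup_le hrhs fun z hz => cubeSup_le hrhs fun w hw => ?_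
  have := h n z w
  rw [hz, hw] at this
  exact this

end BlockModel

end Summit.QuantumFields.BalabanUV.T4Continuum.SliceTorusBlockModel
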